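import Mathlib
import Summits.Ventures.HSemireg.LineLawEulerSufficiency
import Summits.Ventures.HSemireg.TwoAdicLineRule

/-!
# THE LINE LAW (imaginary side) AS ONE KERNEL EQUIVALENCE on Euler's squarefree convenient numbers (ENGINE-W code B, #B28)

LINE-LAW-THEOREMS-B §1 ∕ §4 (c): for a squarefree `k` in Euler's list (one class per genus for `ℤ[√−k]`), a weight line is reached at
`T` iff it passes the SIMPLE LAW at `T`.  Reading «reached» through THEOREM CF⁶ (by value: primitive `z_j` of the prescribed norms
dividing ONE `A − √−k`), both directions are now kernel, and this file states the equivalence in one theorem: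
* `lineLaw_iff_euler` — `k ∈ eulerConvenientNumbers` squarefree, quotients `n > 0`:
  (∃ `A`, every `n` is `N z` for a primitive `z ∣ A − √−k`) ⟺ (every `n` is a primitive norm `x² + k y²`) ∧ (all EVEN `n` are exactly
  divisible by one and the same power `2^e`).
  «⇐» is #B27 `lineLaw_sufficiency_euler` (#B23 ∕ #B26 underneath); «⇒» is PROPOSITION 2 (295 `TwoAdicLineRule.odd_norm_cofactor`:
  the cofactor of an even-norm primitive divisor of `A − √−k` has odd norm, so `v₂(n) = v₂(A² + k)` for every even `n`) plus the
  trivial reading of `z = x + y√−k` as a primitive representation.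
Honest framing: integer ∕ `ℤ√m` arithmetic only; «reached» is THEOREM CF⁶'s datum by value; Mukai vectors and lattices elsewhere, not
objects; nothing here says that HC, HC_CM or HC_AV holds.
-/

namespace Summit.Ventures.HSemireg.LineLawImaginary

open Zsqrtd
open Literature.NumberTheory.QuadraticFields.Quadratic
open Summit.Ventures.HSemireg.LineLawEulerSufficiency (lineLaw_sufficiency_euler)
open Summit.Ventures.HSemireg.TwoAdicLineRule (odd_norm_cofactor norm_A_sub_l)

/-- **PROPOSITION 2 as an exact-valuation statement**: on a line reached at the root `A` (primitive `z ∣ A − √m` of norm `n` for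
each listed `n`, `m < 0`), every EVEN `n` is exactly divisible by `2^e` with `e = v₂(A² − m)`. -/
theorem two_adic_rule_of_reached {m : ℤ} (hm : m < 0) {A : ℤ} (ns : List ℕ) (hpos : ∀ n ∈ ns, 0 < n)
    (h : ∀ n ∈ ns, ∃ z : ℤ√m, z.norm = n ∧ z ∣ (⟨A, -1⟩ : ℤ√m) ∧ IsCoprime z.re z.im) :
    ∀ n ∈ ns, 2 ∣ n → 2 ^ padicValNat 2 (A ^ 2 - m).natAbs ∣ n ∧ ¬ 2 ^ (padicValNat 2 (A ^ 2 - m).natAbs + 1) ∣ n := by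
  intro n hn hn2
  obtain ⟨z, hz, ⟨w, hw⟩, hcop⟩ := h n hn
  have hn0 : n ≠ 0 := (hpos n hn).ne'
  have hwodd : Odd w.norm :=
    odd_norm_cofactor m A z w hcop (by rw [hz]; exact_mod_cast (even_iff_two_dvd.2 hn2)) hw
  have hprod : A ^ 2 - m = (n : ℤ) * w.norm := by rw [← norm_A_sub_l m A, hw, Zsqrtd.norm_mul, hz]
  have hw0 : 0 ≤ w.norm := Zsqrtd.norm_nonneg hm.le w
  have hnat : (A ^ 2 - m).natAbs = n * w.norm.natAbs := by
    rw [hprod, Int.natAbs_mul, Int.natAbs_natCast]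
  have hwodd' : ¬ 2 ∣ w.norm.natAbs := by
    have := Int.natAbs_odd.2 hwodd
    rw [Nat.odd_iff] at this
    omega
  have hwn0 : w.norm.natAbs ≠ 0 := fun h0 => hwodd' (by rw [h0]; exact dvd_zero 2)
  have hval : padicValNat 2 (A ^ 2 - m).natAbs = padicValNat 2 n := by
    rw [hnat, padicValNat.mul hn0 hwn0, padicValNat.eq_zero_of_not_dvd hwodd', add_zero]
  rw [hval]
  exact ⟨pow_padicValNat_dvd, pow_succ_padicValNat_not_dvd hn0⟩

/-- **THE LINE LAW, imaginary side, as one equivalence** (LINE-LAW-THEOREMS-B §4 (c) on Euler's 37 squarefree convenient numbers;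
«reached at the root A» = THEOREM CF⁶'s datum): for `k ∈ eulerConvenientNumbers` squarefree and positive quotients `n`,
some `A` has every `n` the norm of a primitive divisor of `A − √−k` IFF every `n` is a primitive norm `x² + k y²` AND the even `n`
are all exactly divisible by one power `2^e` (the SIMPLE LAW: representability + PROPOSITION 2's 2-ADIC RULE). -/
theorem lineLaw_iff_euler {k : ℕ} (hk : k ∈ eulerConvenientNumbers) (hsq : Squarefree (k : ℤ)) (ns : List ℕ)
    (hpos : ∀ n ∈ ns, 0 < n) :
    (∃ A : ℤ, ∀ n ∈ ns, ∃ z : ℤ√(-(k : ℤ)), z.norm = n ∧ z ∣ (⟨A, -1⟩ : ℤ√(-(k : ℤ))) ∧ IsCoprime z.re z.im) ↔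
      ((∀ n ∈ ns, ∃ x y : ℤ, x ^ 2 + k * y ^ 2 = n ∧ IsCoprime x y) ∧
        ∃ e : ℕ, ∀ n ∈ ns, 2 ∣ n → 2 ^ e ∣ n ∧ ¬ 2 ^ (e + 1) ∣ n) := by
  have hk0 : 0 < k := by
    rcases Nat.eq_zero_or_pos k with h | h
    · exfalso
      rw [h] at hsq
      exact not_squarefree_zero (by exact_mod_cast hsq)
    · exact h
  have hm : (-(k : ℤ)) < 0 := by omega
  constructor
  · rintro ⟨A, hA⟩
    refine ⟨fun n hn => ?_, ⟨padicValNat 2 (A ^ 2 - (-(k : ℤ))).natAbs, two_adic_rule_of_reached hm ns hpos hA⟩⟩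
    obtain ⟨z, hz, -, hcop⟩ := hA n hn
    refine ⟨z.re, z.im, ?_, hcop⟩
    rw [← hz, Zsqrtd.norm_def]
    ring
  · rintro ⟨hrep, e, he⟩
    exact lineLaw_sufficiency_euler hk hsq ns (fun n hn => ⟨hpos n hn, hrep n hn⟩) e (fun _ => he)

/-- **Instance in numbers (`k = 5`, Euler's list, squarefree)**: quotients `6 = N(1 − √−5)` (even, `2¹‖6`) and `9 = N(2 + √−5)`
at the common root `A = 7`: `7² + 5 = 54 = 6·9`, `(1 − √−5)(2 + √−5) = 7 − √−5 = (2 + √−5)(1 − √−5)` — both sides of the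
equivalence in numbers for the list `[6, 9]`. -/
example : (7 : ℤ) ^ 2 + 5 = 6 * 9 ∧ (⟨1, -1⟩ : ℤ√(-5)) * ⟨2, 1⟩ = ⟨7, -1⟩ ∧ (⟨2, 1⟩ : ℤ√(-5)) * ⟨1, -1⟩ = ⟨7, -1⟩ := by
  refine ⟨by norm_num, by ext <;> simp, by ext <;> simp⟩

end Summit.Ventures.HSemireg.LineLawImaginary
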